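import Literature.Probability.MarkovChains.LeapfrogIntegrator
import Mathlib.Analysis.SpecialFunctions.Trigonometric.Inverse
import Mathlib.Analysis.SpecialFunctions.Pow.Real
import Mathlib.Analysis.SpecificLimits.Basic
import Mathlib.LinearAlgebra.Matrix.Trace
import Mathlib.LinearAlgebra.Matrix.Determinant.Basic
import HarnessLib

/-!
# The leapfrog integrator on a harmonic mode: exact invariant, `δH`, the stability wall `ωδτ = 2`

Sequel to `LeapfrogIntegrator.lean` (reversibility and area preservation for ANY force).  This
file treats the one force for which everything is explicit — a single harmonic mode, i.e. free
field theory mode by mode — following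

B. Joó, B. Pendleton, A. D. Kennedy, A. C. Irving, J. C. Sexton, S. M. Pickles, S. P. Booth
(UKQCD), *Instability in the molecular dynamics step of a hybrid Monte Carlo algorithm in
dynamical fermion lattice QCD simulations*, Phys. Rev. D 62 (2000) 114501 [JooEtAl2000], §4.1–§4.2
(held text paper:arxiv-hep-lat_0005023 p0010–p0011):

> §4.1 … `H = ½(π² + ω²φ²)` … The leapfrog update for the coordinate and momentum may be written
> in the form of a matrix `𝒰₃(δτ)` acting on the phase space vector `(φ, π)`:
> `𝒰₃(δτ) = [[1 − ½ω²δτ², δτ], [−ω²δτ + ¼ω⁴δτ³, 1 − ½ω²δτ²]]`.  The update matrix can be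
> parameterised as `[[cos κδτ, sin κδτ/ρ], [−ρ sin κδτ, cos κδτ]]` where
> `κ(δτ) = cos⁻¹(1 − ½ω²δτ²)/δτ`, `ρ(δτ) = ω√(1 − ¼ω²δτ²)`.  Evolution over a whole trajectory
> of length `τ` is then `[[cos κτ, sin κτ/ρ], [−ρ sin κτ, cos κτ]]` … for an oscillator released
> from amplitude `A` … `(φ(τ), π(τ)) = (A cos κτ, −Aρ sin κτ)`.  The phase space orbits therefore
> satisfy `φ²/A² + π²/(A²ρ²) = 1` … for `ωδτ < 2` the phase space trajectories are elliptical,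
> whereas for `ωδτ > 2` they are hyperbolic.  The instability at `ωδτ = 2` is the abrupt
> transition … `δH = −⅛ ω⁴A²δτ² sin²[κ(δτ)τ]`.  When `ωδτ < 2`, `κ` is real and so `δH` oscillates
> … when `ωδτ > 2`, `κ` becomes purely imaginary causing `δH` to diverge.
> §4.2 … area preservation … implies that `det(𝒰₃(δτ)) = 1`. … either 1) … the eigenvalues have
> magnitude unity: `λ_{1,2} = e^{±iθ}` … stable elliptical trajectories … 2) … `λ₁ = η` and
> `λ₂ = 1/η` for some real `η` … one of the eigenvalues of `𝒰₃(τ)` will show an exponential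
> divergence with `N_MD`. … the discriminant is `D₃ = (ωδτ)²(ωδτ − 2)(ωδτ + 2)`; for
> `0 < ωδτ < 2` the discriminant is negative indicating a stable integrator, whereas for
> `ωδτ > 2` … positive implying an unstable integrator.

and the analysis it reviews, R. G. Edwards, I. Horváth, A. D. Kennedy, *Instabilities and
non-reversibility of molecular dynamics trajectories*, Nucl. Phys. B 484 (1997) 375
[EdwardsHorvathKennedy1996], §5.1 (held text paper:arxiv-hep-lat_9606004 p0007):

> The Hamiltonian is diagonal, so we may temporarily consider the evolution of a single mode …
> `U(δτ) = [[1 − ½δτ², δτ], [−δτ + ¼δτ³, 1 − ½δτ²]]` [footnote: If `F ≡ diag(1, −1)` is the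
> momentum-flip operation then `F⁻¹U(δτ)F = U(−δτ)` … Furthermore `U(δτ)U(−δτ) = 𝟙`] … It is
> clear that some kind of critical behavior will occur at `δτ = 2`. … `T` rapidly approaches its
> asymptotic behavior of growing proportionally to `e^{ντ}` … For `δτ ≤ 2` not only is the
> exponent `ν` zero, but `T` is bounded by a constant.
> §5.3 … For QCD computations using the HMC algorithm the pseudofermions produce a force which we
> expect to be proportional to `1/m_f`, so the "highest frequency" of the system, which is
> responsible for the integration instability, will grow as `ω_max ∝ 1/m_f` too.

This file PROVES, for one mode of frequency `ω` and step `h = δτ` (exact arithmetic):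

* `hoStep ω h` — the update `𝒰₃(δτ)` as a map on `(φ, π) ∈ ℝ × ℝ`; `hoStep_eq` (it IS half kick ∘
  drift ∘ half kick for the force `−ω²φ`), `leapfrogStep_linearForce` / `leapfrog_linearForce`
  (the tree's `leapfrogStep`/`leapfrog` for the diagonal force `F(φ)_i = −ω_i² φ_i` act mode by
  mode as `hoStep (ω i) h` — "the Hamiltonian is diagonal"); `hoMatrix`, `hoMatrix_mulVec`,
  `det_hoMatrix` (`= 1`, area preservation), `trace_hoMatrix` (`= 2 − ω²h²`), `discr_hoMatrix`
  (`tr² − 4 det = (ωh)²(ωh − 2)(ωh + 2)` = Joó's `D₃`); `hoStep_neg_hoStep` (`U(−h)U(h) = 1`) and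
  `hoStep_flip` (`F U(h) F = U(−h)`);
* `hoShadow_hoStep`, `hoShadow_iterate` — the quadratic form `½(π² + ρ²φ²)`,
  `ρ² = ω²(1 − ¼ω²h²)`, is EXACTLY invariant under every step (the conic
  `φ²/A² + π²/(A²ρ²) = 1`), for every `h`;
* `hoEnergy_iterate_sub` — hence `δH` after `n` steps is EXACTLY `⅛ ω⁴h² (φ_n² − φ_0²)`;
* STABLE SIDE `ωh < 2` (`ρ² > 0`): `rhoSq_pos`, bounded orbits `rhoSq_mul_sq_fst_iterate_le` /
  `sq_snd_iterate_le`, and **`abs_deltaH_iterate_le`: `|δH_n| ≤ (ωh)²/(4 − (ωh)²) · H(φ_0, π_0)`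
  uniformly in `n`** ("`δH` oscillates"; "bounded by a constant"); the rotation form
  `hoStep_iterate_eq_rotation` (`𝒰₃ⁿ = [[cos nθ, sin nθ/ρ], [−ρ sin nθ, cos nθ]]`,
  `cos θ = 1 − ½ω²h²`, `θ = κδτ`), the printed orbit `iterate_amplitude` (`(A cos nθ, −Aρ sin nθ)`)
  and the printed `deltaH_amplitude` (`δH = −⅛ ω⁴A²h² sin²(nθ)`);
* UNSTABLE SIDE `ωh > 2`: `rhoSq_neg`, `discr_pos`, the real eigenvalues `lamPlus`/`lamMinus`
  (`= 1 − ½x² ± x√(¼x² − 1)`, `x = ωh`; `lamPlus_mul_lamMinus = 1`, `lamPlus_add_lamMinus = 2 − x²`,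
  `lamMinus_lt_neg_one`, `lamMinus_charpoly`), an explicit eigenvector `hoStep_eigMinus`
  (`𝒰₃ v₋ = λ₋ v₋`, `v₋ = (h, λ₋ − (1 − ½x²))`), `iterate_eigMinus` (`𝒰₃ⁿ v₋ = λ₋ⁿ v₋`),
  and **`tendsto_hoEnergy_iterate_atTop`: along `v₋` the energy violation
  `δH_n = ⅛ω⁴h⁴(λ₋^{2n} − 1)` diverges geometrically** ("exponential divergence with `N_MD`");
* the WALL `ωh = 2`: `hoStep_wall`, `iterate_wall` (`𝒰₃ = [[−1, h], [0, −1]]`, iterates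
  `((−1)ⁿ(φ − n h π), (−1)ⁿπ)`: linear growth).

Scope (honest): one real mode / a diagonal (free) force only; the statistical statements of
[EdwardsHorvathKennedy1996] §5.1–5.2 (the law of `δH`, `P_acc = (2/π) tan⁻¹(2/T)`, the
`V δτ⁴` scaling) and everything about interacting theories (§5.3's `ω_max ∝ 1/m_f` is a
CONJECTURE there, tested numerically in [JooEtAl2000] §4.4–§5) are NOT formalised; higher-order
schemes ([JooEtAl2000] §4.3) are not treated.  No floating-point effects: all statements are in
exact arithmetic, as in both sources' §4.1/§5.1.

## References
* [JooEtAl2000] B. Joó et al. (UKQCD), Phys. Rev. D 62 (2000) 114501, arXiv:hep-lat/0005023,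
  §4.1 (update matrix `𝒰₃`, parameterisation `κ, ρ`, orbit conic, `δH`), §4.2 (det, eigenvalue
  dichotomy, discriminant `D₃`).
* [EdwardsHorvathKennedy1996] R. G. Edwards, I. Horváth, A. D. Kennedy, Nucl. Phys. B 484 (1997)
  375–402, arXiv:hep-lat/9606004, §5.1 (single mode analysis, footnote on reversibility, the wall
  at `δτ = 2`), §5.3.
* [MontvayMunster1994] I. Montvay, G. Münster, *Quantum Fields on a Lattice*, CUP (1994), §7.6.1
  (7.230)–(7.235) (the leapfrog scheme; through `LeapfrogIntegrator.lean`).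
-/

noncomputable section

open Real Filter

namespace Literature.Probability.MarkovChains.HMC

namespace Harmonic

/-! ### The update map `𝒰₃(δτ)` of one mode -/

/-- The leapfrog update of one harmonic mode `H = ½(π² + ω²φ²)` with step `h = δτ`, as a map on
the phase-space vector `(φ, π)`:
`𝒰₃(δτ) = [[1 − ½ω²δτ², δτ], [−ω²δτ + ¼ω⁴δτ³, 1 − ½ω²δτ²]]`.
[cite: JooEtAl2000, §4.1 (update matrix 𝒰₃(δτ))] [cite: EdwardsHorvathKennedy1996, §5.1 (U(δτ))] -/
def hoStep (ω h : ℝ) (v : ℝ × ℝ) : ℝ × ℝ :=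
  ((1 - ω ^ 2 * h ^ 2 / 2) * v.1 + h * v.2,
   (-(ω ^ 2 * h) + ω ^ 4 * h ^ 3 / 4) * v.1 + (1 - ω ^ 2 * h ^ 2 / 2) * v.2)

/-- The fictitious energy of the mode, `H = ½(π² + ω²φ²)`. [cite: JooEtAl2000, §4.1 (4.1)] -/
def hoEnergy (ω : ℝ) (v : ℝ × ℝ) : ℝ := (v.2 ^ 2 + ω ^ 2 * v.1 ^ 2) / 2

/-- `ρ(δτ)² = ω²(1 − ¼ω²δτ²)` — the squared semi-axis ratio of the leapfrog orbit.
[cite: JooEtAl2000, §4.1 (ρ(δτ) = ω√(1 − ¼ω²δτ²))] [cite: EdwardsHorvathKennedy1996, §5.1] -/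
def rhoSq (ω h : ℝ) : ℝ := ω ^ 2 * (1 - ω ^ 2 * h ^ 2 / 4)

/-- The quadratic form `½(π² + ρ²φ²)` whose level sets `φ²/A² + π²/(A²ρ²) = 1` are the leapfrog
orbits (ellipses for `ωδτ < 2`, hyperbolas for `ωδτ > 2`). [cite: JooEtAl2000, §4.1 (phase space
orbits φ²/A² + π²/(A²ρ²) = 1)] -/
def hoShadow (ω h : ℝ) (v : ℝ × ℝ) : ℝ := (v.2 ^ 2 + rhoSq ω h * v.1 ^ 2) / 2

/-- First row of `𝒰₃(δτ)`: `φ' = (1 − ½ω²δτ²)φ + δτ π`. [cite: JooEtAl2000, §4.1 (𝒰₃(δτ))] -/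
@[simp] theorem hoStep_fst (ω h : ℝ) (v : ℝ × ℝ) :
    (hoStep ω h v).1 = (1 - ω ^ 2 * h ^ 2 / 2) * v.1 + h * v.2 := rfl

/-- Second row of `𝒰₃(δτ)`: `π' = (−ω²δτ + ¼ω⁴δτ³)φ + (1 − ½ω²δτ²)π`.
[cite: JooEtAl2000, §4.1 (𝒰₃(δτ))] -/
@[simp] theorem hoStep_snd (ω h : ℝ) (v : ℝ × ℝ) :
    (hoStep ω h v).2 = (-(ω ^ 2 * h) + ω ^ 4 * h ^ 3 / 4) * v.1 + (1 - ω ^ 2 * h ^ 2 / 2) * v.2 :=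
  rfl

/-- **`𝒰₃` IS the leapfrog step**: half kick `π ↦ π − ½h ω²φ`, drift `φ ↦ φ + hπ`, half kick —
the `n = 1` scheme (7.235) for the force `−ω²φ`. [cite: JooEtAl2000, §4.1 ("The leapfrog update …
may be written in the form of a matrix 𝒰₃(δτ)")] [cite: MontvayMunster1994, §7.6.1 (7.235)] -/
theorem hoStep_eq (ω h : ℝ) (v : ℝ × ℝ) :
    hoStep ω h v =
      (v.1 + h * (v.2 + h / 2 * (-(ω ^ 2 * v.1))),
       (v.2 + h / 2 * (-(ω ^ 2 * v.1))) +
         h / 2 * (-(ω ^ 2 * (v.1 + h * (v.2 + h / 2 * (-(ω ^ 2 * v.1))))))) := by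
  refine Prod.ext ?_ ?_ <;> simp only [hoStep_fst, hoStep_snd] <;> ring

/-- The diagonal ("free field") force `F(φ)_i = −ω_i² φ_i` of `H = ½ Σ_i (π_i² + ω_i² φ_i²)`.
[cite: EdwardsHorvathKennedy1996, §5 (H = ½ Σ_p (π_p² + ω_p² φ_p²))] -/
def linearForce {ι : Type*} (ω : ι → ℝ) (φ : ι → ℝ) : ι → ℝ := fun i => -(ω i ^ 2 * φ i)

/-- **"The Hamiltonian is diagonal, so we may … consider the evolution of a single mode"**: the
tree's `leapfrogStep` for the diagonal force acts on mode `i` as `hoStep (ω i) h`.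
[cite: EdwardsHorvathKennedy1996, §5.1] [cite: JooEtAl2000, §4.1] -/
theorem leapfrogStep_linearForce {ι : Type*} (ω : ι → ℝ) (h : ℝ) (x : PhaseSpace ι) (i : ι) :
    ((leapfrogStep (linearForce ω) h x).1 i, (leapfrogStep (linearForce ω) h x).2 i) =
      hoStep (ω i) h (x.1 i, x.2 i) := by
  rw [hoStep_eq]
  simp only [leapfrogStep, Function.comp_apply, kick, drift, linearForce, Pi.add_apply,
    Pi.smul_apply, smul_eq_mul]

/-- The same for whole trajectories: `n` leapfrog steps of the free field act on mode `i` as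
`(hoStep (ω i) h)^[n]`. [cite: EdwardsHorvathKennedy1996, §5.1 (U(τ) for τ/δτ steps)]
[cite: JooEtAl2000, §4.1 (𝒰₃(τ) = 𝒰₃^{N_MD}(δτ))] -/
theorem leapfrog_linearForce {ι : Type*} (ω : ι → ℝ) (h : ℝ) (n : ℕ) (x : PhaseSpace ι) (i : ι) :
    ((leapfrog (linearForce ω) h n x).1 i, (leapfrog (linearForce ω) h n x).2 i) =
      (hoStep (ω i) h)^[n] (x.1 i, x.2 i) := by
  induction n with
  | zero => simp [leapfrog]
  | succ n ih =>
    rw [leapfrog_succ, Function.iterate_succ_apply', ← ih, leapfrogStep_linearForce]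

/-! ### The matrix `𝒰₃(δτ)`: determinant, trace, discriminant -/

/-- The update matrix `𝒰₃(δτ)`. [cite: JooEtAl2000, §4.1 (𝒰₃(δτ))]
[cite: EdwardsHorvathKennedy1996, §5.1 (U(δτ))] -/
def hoMatrix (ω h : ℝ) : Matrix (Fin 2) (Fin 2) ℝ :=
  !![1 - ω ^ 2 * h ^ 2 / 2, h; -(ω ^ 2 * h) + ω ^ 4 * h ^ 3 / 4, 1 - ω ^ 2 * h ^ 2 / 2]

/-- `𝒰₃(δτ)` acting on the phase-space vector `(φ, π)` is `hoStep`. [cite: JooEtAl2000, §4.1] -/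
theorem hoMatrix_mulVec (ω h a b : ℝ) :
    Matrix.mulVec (hoMatrix ω h) ![a, b] = ![(hoStep ω h (a, b)).1, (hoStep ω h (a, b)).2] := by
  ext i
  fin_cases i <;> simp [hoMatrix, Matrix.mulVec, dotProduct, Fin.sum_univ_two]

/-- **Area preservation: `det 𝒰₃(δτ) = 1`** (for every `ω`, `δτ`). [cite: JooEtAl2000, §4.2 ("The
area preservation property of the integrator implies that det(𝒰₃(δτ)) = 1")] -/
theorem det_hoMatrix (ω h : ℝ) : (hoMatrix ω h).det = 1 := by
  rw [hoMatrix, Matrix.det_fin_two_of]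
  ring

/-- `tr 𝒰₃(δτ) = 2 − ω²δτ²` (real). [cite: JooEtAl2000, §4.2 ("Tr 𝒰₃ is also real")] -/
theorem trace_hoMatrix (ω h : ℝ) : (hoMatrix ω h).trace = 2 - ω ^ 2 * h ^ 2 := by
  rw [hoMatrix, Matrix.trace_fin_two_of]
  ring

/-- **The discriminant of the characteristic polynomial `λ² − (tr)λ + det`**:
`tr² − 4 det = (ωδτ)²(ωδτ − 2)(ωδτ + 2) = D₃`. [cite: JooEtAl2000, §4.2 (D₃ = (ωδτ)²(ωδτ−2)(ωδτ+2))] -/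
theorem discr_hoMatrix (ω h : ℝ) :
    (hoMatrix ω h).trace ^ 2 - 4 * (hoMatrix ω h).det = (ω * h) ^ 2 * (ω * h - 2) * (ω * h + 2) := by
  rw [trace_hoMatrix, det_hoMatrix]
  ring

/-- `D₃ < 0` for `0 < ωδτ < 2` ("indicating a stable integrator"). [cite: JooEtAl2000, §4.2] -/
theorem discr_neg {ω h : ℝ} (hω : 0 < ω) (hh : 0 < h) (hlt : ω * h < 2) :
    (hoMatrix ω h).trace ^ 2 - 4 * (hoMatrix ω h).det < 0 := by
  rw [discr_hoMatrix]
  have h1 : 0 < (ω * h) ^ 2 := by positivity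
  have h2 : ω * h - 2 < 0 := by linarith
  have h3 : 0 < ω * h + 2 := by nlinarith
  exact mul_neg_of_neg_of_pos (mul_neg_of_pos_of_neg h1 h2) h3

/-- `D₃ > 0` for `ωδτ > 2` ("implying an unstable integrator"). [cite: JooEtAl2000, §4.2] -/
theorem discr_pos {ω h : ℝ} (hgt : 2 < ω * h) :
    0 < (hoMatrix ω h).trace ^ 2 - 4 * (hoMatrix ω h).det := by
  rw [discr_hoMatrix]
  have h1 : 0 < (ω * h) ^ 2 := by positivity
  have h2 : 0 < ω * h - 2 := by linarith
  have h3 : 0 < ω * h + 2 := by linarith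
  positivity

/-- `U(−δτ) U(δτ) = 𝟙`: the step is inverted by the step with `−δτ`.
[cite: EdwardsHorvathKennedy1996, §5.1 footnote ("U(δτ)U(−δτ) = 𝟙")] -/
theorem hoStep_neg_hoStep (ω h : ℝ) (v : ℝ × ℝ) : hoStep ω (-h) (hoStep ω h v) = v := by
  refine Prod.ext ?_ ?_ <;> simp only [hoStep_fst, hoStep_snd] <;> ring

/-- `F U(δτ) F = U(−δτ)` with `F` the momentum flip: reversibility of the linear map.
[cite: EdwardsHorvathKennedy1996, §5.1 footnote ("F⁻¹U(δτ)F = U(−δτ)")] -/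
theorem hoStep_flip (ω h : ℝ) (v : ℝ × ℝ) :
    hoStep ω h (v.1, -v.2) = ((hoStep ω (-h) v).1, -(hoStep ω (-h) v).2) := by
  refine Prod.ext ?_ ?_ <;> simp only [hoStep_fst, hoStep_snd] <;> ring

/-! ### The exact invariant and the exact energy violation -/

/-- **The leapfrog orbit lies on the conic `π² + ρ²φ² = const`**: the quadratic form
`½(π² + ρ²φ²)`, `ρ² = ω²(1 − ¼ω²δτ²)`, is EXACTLY conserved by every step, for every `ω` and `δτ`.
[cite: JooEtAl2000, §4.1 (orbits φ²/A² + π²/(A²ρ²) = 1)] [cite: EdwardsHorvathKennedy1996, §5.1] -/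
theorem hoShadow_hoStep (ω h : ℝ) (v : ℝ × ℝ) : hoShadow ω h (hoStep ω h v) = hoShadow ω h v := by
  simp only [hoShadow, rhoSq, hoStep_fst, hoStep_snd]
  ring

/-- … hence along the whole trajectory. [cite: JooEtAl2000, §4.1 (orbit conic for 𝒰₃(τ))] -/
theorem hoShadow_iterate (ω h : ℝ) (n : ℕ) (v : ℝ × ℝ) :
    hoShadow ω h ((hoStep ω h)^[n] v) = hoShadow ω h v := by
  induction n with
  | zero => rfl
  | succ n ih => rw [Function.iterate_succ_apply', hoShadow_hoStep, ih]

/-- `H = ½(π² + ρ²φ²) + ⅛ ω⁴δτ² φ²`: the energy differs from the invariant by a multiple of `φ²`.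
[cite: JooEtAl2000, §4.1 (δH computation)] -/
theorem hoEnergy_eq_hoShadow_add (ω h : ℝ) (v : ℝ × ℝ) :
    hoEnergy ω v = hoShadow ω h v + ω ^ 4 * h ^ 2 / 8 * v.1 ^ 2 := by
  simp only [hoEnergy, hoShadow, rhoSq]
  ring

/-- **Exact energy violation after `n` steps**: `δH_n = ⅛ ω⁴δτ² (φ_n² − φ_0²)`.
[cite: JooEtAl2000, §4.1 (δH = H(φ(τ),π(τ)) − H(φ(0),π(0)))] -/
theorem hoEnergy_iterate_sub (ω h : ℝ) (n : ℕ) (v : ℝ × ℝ) :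
    hoEnergy ω ((hoStep ω h)^[n] v) - hoEnergy ω v =
      ω ^ 4 * h ^ 2 / 8 * (((hoStep ω h)^[n] v).1 ^ 2 - v.1 ^ 2) := by
  rw [hoEnergy_eq_hoShadow_add ω h, hoEnergy_eq_hoShadow_add ω h v, hoShadow_iterate]
  ring

/-! ### The stable side `ωδτ < 2`: bounded orbits, bounded `δH`, the rotation form -/

/-- `ρ² > 0` iff the mode is on the stable side: for `0 < ω` and `ω²δτ² < 4`.
[cite: JooEtAl2000, §4.1 ("for ωδτ < 2 the phase space trajectories are elliptical")] -/
theorem rhoSq_pos {ω h : ℝ} (hω : 0 < ω) (hlt : ω ^ 2 * h ^ 2 < 4) : 0 < rhoSq ω h := by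
  unfold rhoSq
  have h1 : 0 < 1 - ω ^ 2 * h ^ 2 / 4 := by linarith
  positivity

/-- `ρ² ≤ ω²`. [cite: JooEtAl2000, §4.1 (ρ = ω√(1 − ¼ω²δτ²))] -/
theorem rhoSq_le (ω h : ℝ) : rhoSq ω h ≤ ω ^ 2 := by
  unfold rhoSq
  nlinarith [sq_nonneg ω, sq_nonneg h, sq_nonneg (ω * h), sq_nonneg (ω ^ 2 * h)]

/-- The invariant is dominated by the energy: `½(π² + ρ²φ²) ≤ H`. [cite: JooEtAl2000, §4.1] -/
theorem hoShadow_le_hoEnergy (ω h : ℝ) (v : ℝ × ℝ) : hoShadow ω h v ≤ hoEnergy ω v := by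
  rw [hoEnergy_eq_hoShadow_add ω h]
  have : 0 ≤ ω ^ 4 * h ^ 2 / 8 * v.1 ^ 2 := by positivity
  linarith

/-- **Bounded orbits (elliptical trajectories)**: on the stable side, `ρ² φ_n² ≤ π_0² + ρ²φ_0²`
for all `n`. [cite: JooEtAl2000, §4.1 (elliptical orbits for ωδτ < 2)]
[cite: EdwardsHorvathKennedy1996, §5.1 ("For δτ ≤ 2 … T is bounded by a constant")] -/
theorem rhoSq_mul_sq_fst_iterate_le (ω h : ℝ) (n : ℕ) (v : ℝ × ℝ) :
    rhoSq ω h * ((hoStep ω h)^[n] v).1 ^ 2 ≤ 2 * hoShadow ω h v := by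
  rw [← hoShadow_iterate ω h n v]
  simp only [hoShadow]
  nlinarith [sq_nonneg ((hoStep ω h)^[n] v).2]

/-- … and `π_n² ≤ π_0² + ρ²φ_0²` for all `n` (when `ρ² ≥ 0`). [cite: JooEtAl2000, §4.1] -/
theorem sq_snd_iterate_le {ω h : ℝ} (hρ : 0 ≤ rhoSq ω h) (n : ℕ) (v : ℝ × ℝ) :
    ((hoStep ω h)^[n] v).2 ^ 2 ≤ 2 * hoShadow ω h v := by
  rw [← hoShadow_iterate ω h n v]
  simp only [hoShadow]
  nlinarith [mul_nonneg hρ (sq_nonneg ((hoStep ω h)^[n] v).1)]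

/-- **`δH` stays bounded on the stable side ("δH oscillates")**: for `0 < ω` and `ω²δτ² < 4`,
`|δH_n| ≤ (ωδτ)²/(4 − (ωδτ)²) · H(φ_0, π_0)` for EVERY number of steps `n`.
[cite: JooEtAl2000, §4.1 ("When ωδτ < 2 … δH oscillates with increasing τ")]
[cite: EdwardsHorvathKennedy1996, §5.1 ("For δτ ≤ 2 not only is the exponent ν zero, but T is
bounded by a constant")] -/
theorem abs_deltaH_iterate_le {ω h : ℝ} (hω : 0 < ω) (hlt : ω ^ 2 * h ^ 2 < 4) (n : ℕ)
    (v : ℝ × ℝ) :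
    |hoEnergy ω ((hoStep ω h)^[n] v) - hoEnergy ω v| ≤
      ω ^ 2 * h ^ 2 / (4 - ω ^ 2 * h ^ 2) * hoEnergy ω v := by
  have hρ := rhoSq_pos hω hlt
  have hS0 : 0 ≤ hoShadow ω h v := by
    simp only [hoShadow]
    have := mul_nonneg hρ.le (sq_nonneg v.1)
    positivity
  have hH := hoShadow_le_hoEnergy ω h v
  have h4 : 0 < 4 - ω ^ 2 * h ^ 2 := by linarith
  -- both `φ_n²` and `φ_0²` lie in `[0, 2S/ρ²]`
  have hn := rhoSq_mul_sq_fst_iterate_le ω h n v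
  have h0 := rhoSq_mul_sq_fst_iterate_le ω h 0 v
  simp only [Function.iterate_zero, id_eq] at h0
  rw [hoEnergy_iterate_sub, abs_le]
  -- `ρ² = ω²(4 − ω²h²)/4`, so `ω⁴h²/8 · (2S/ρ²) = ω²h²/(4 − ω²h²) · S ≤ … · H`
  have key : ω ^ 4 * h ^ 2 / 8 * (2 * hoShadow ω h v / rhoSq ω h) =
      ω ^ 2 * h ^ 2 / (4 - ω ^ 2 * h ^ 2) * hoShadow ω h v := by
    unfold rhoSq
    have hω0 : ω ≠ 0 := hω.ne'
    field_simp
    ring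
  have hbound : ω ^ 2 * h ^ 2 / (4 - ω ^ 2 * h ^ 2) * hoShadow ω h v ≤
      ω ^ 2 * h ^ 2 / (4 - ω ^ 2 * h ^ 2) * hoEnergy ω v :=
    mul_le_mul_of_nonneg_left hH (by positivity)
  have hφn : ((hoStep ω h)^[n] v).1 ^ 2 ≤ 2 * hoShadow ω h v / rhoSq ω h := by
    rw [le_div_iff₀ hρ, mul_comm]; exact hn
  have hφ0 : v.1 ^ 2 ≤ 2 * hoShadow ω h v / rhoSq ω h := by
    rw [le_div_iff₀ hρ, mul_comm]; exact h0
  have hc : 0 ≤ ω ^ 4 * h ^ 2 / 8 := by positivity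
  constructor
  · -- lower: `−bound ≤ c (φ_n² − φ_0²)` since `c φ_0² ≤ bound`
    have h1 : ω ^ 4 * h ^ 2 / 8 * v.1 ^ 2 ≤ ω ^ 2 * h ^ 2 / (4 - ω ^ 2 * h ^ 2) * hoEnergy ω v := by
      calc ω ^ 4 * h ^ 2 / 8 * v.1 ^ 2 ≤ ω ^ 4 * h ^ 2 / 8 * (2 * hoShadow ω h v / rhoSq ω h) :=
            mul_le_mul_of_nonneg_left hφ0 hc
        _ ≤ _ := by rw [key]; exact hbound
    nlinarith [mul_nonneg hc (sq_nonneg ((hoStep ω h)^[n] v).1)]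
  · have h1 : ω ^ 4 * h ^ 2 / 8 * ((hoStep ω h)^[n] v).1 ^ 2 ≤
        ω ^ 2 * h ^ 2 / (4 - ω ^ 2 * h ^ 2) * hoEnergy ω v := by
      calc ω ^ 4 * h ^ 2 / 8 * ((hoStep ω h)^[n] v).1 ^ 2
          ≤ ω ^ 4 * h ^ 2 / 8 * (2 * hoShadow ω h v / rhoSq ω h) := mul_le_mul_of_nonneg_left hφn hc
        _ ≤ _ := by rw [key]; exact hbound
    nlinarith [mul_nonneg hc (sq_nonneg v.1)]

/-- The rotation angle per step: `θ = κ(δτ)δτ = cos⁻¹(1 − ½ω²δτ²)`.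
[cite: JooEtAl2000, §4.1 (κ(δτ) = cos⁻¹(1 − ½ω²δτ²)/δτ)] [cite: EdwardsHorvathKennedy1996, §5.1] -/
def theta (ω h : ℝ) : ℝ := Real.arccos (1 - ω ^ 2 * h ^ 2 / 2)

/-- `cos θ = 1 − ½ω²δτ²` (valid whenever `ω²δτ² ≤ 4`). [cite: JooEtAl2000, §4.1] -/
theorem cos_theta {ω h : ℝ} (hle : ω ^ 2 * h ^ 2 ≤ 4) : Real.cos (theta ω h) = 1 - ω ^ 2 * h ^ 2 / 2 := by
  unfold theta
  rw [Real.cos_arccos (by linarith) (by nlinarith [sq_nonneg ω, sq_nonneg h, sq_nonneg (ω * h)])]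

/-- `sin θ = δτ·ρ = ωδτ√(1 − ¼ω²δτ²)` for `0 ≤ δτ` and `ω²δτ² ≤ 4` (so that the `(1,2)` entry
`sin θ/ρ` of the parameterised matrix is `δτ`). [cite: JooEtAl2000, §4.1 (parameterisation of 𝒰₃)] -/
theorem sin_theta {ω h : ℝ} (hh : 0 ≤ h) (hle : ω ^ 2 * h ^ 2 ≤ 4) :
    Real.sin (theta ω h) = h * Real.sqrt (rhoSq ω h) := by
  unfold theta
  rw [Real.sin_arccos]
  have hρ : 0 ≤ rhoSq ω h := by
    unfold rhoSq
    have : 0 ≤ 1 - ω ^ 2 * h ^ 2 / 4 := by linarith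
    positivity
  have h1 : 1 - (1 - ω ^ 2 * h ^ 2 / 2) ^ 2 = (h * Real.sqrt (rhoSq ω h)) ^ 2 := by
    rw [mul_pow, Real.sq_sqrt hρ]
    unfold rhoSq
    ring
  rw [h1, Real.sqrt_sq (mul_nonneg hh (Real.sqrt_nonneg _))]

/-- **The rotation form of the trajectory**: for `0 < ω`, `0 ≤ δτ`, `ω²δτ² < 4`, with
`ρ = ω√(1 − ¼ω²δτ²)` and `θ = cos⁻¹(1 − ½ω²δτ²)`,
`𝒰₃(δτ)ⁿ (φ, π) = (cos(nθ) φ + (sin(nθ)/ρ) π, −ρ sin(nθ) φ + cos(nθ) π)` — "evolution over a whole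
trajectory of length `τ`" `= [[cos κτ, sin κτ/ρ], [−ρ sin κτ, cos κτ]]`.
[cite: JooEtAl2000, §4.1 (𝒰₃(τ))] [cite: EdwardsHorvathKennedy1996, §5.1 (U(τ))] -/
theorem hoStep_iterate_eq_rotation {ω h : ℝ} (hω : 0 < ω) (hh : 0 ≤ h) (hlt : ω ^ 2 * h ^ 2 < 4)
    (n : ℕ) (v : ℝ × ℝ) :
    (hoStep ω h)^[n] v =
      (Real.cos (n * theta ω h) * v.1 + Real.sin (n * theta ω h) / Real.sqrt (rhoSq ω h) * v.2,
       -(Real.sqrt (rhoSq ω h) * Real.sin (n * theta ω h)) * v.1 + Real.cos (n * theta ω h) * v.2) := by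
  set ρ := Real.sqrt (rhoSq ω h) with hρdef
  have hρ2 : ρ ^ 2 = rhoSq ω h := Real.sq_sqrt (rhoSq_pos hω hlt).le
  have hρ0 : ρ ≠ 0 := (Real.sqrt_pos.mpr (rhoSq_pos hω hlt)).ne'
  have hc := cos_theta hlt.le
  have hs := sin_theta hh hlt.le
  rw [← hρdef] at hs
  induction n with
  | zero => simp
  | succ n ih =>
    rw [Function.iterate_succ_apply', ih]
    have e1 : ((n + 1 : ℕ) : ℝ) * theta ω h = n * theta ω h + theta ω h := by push_cast; ring
    rw [e1, Real.cos_add, Real.sin_add, hc, hs]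
    -- the `(2,1)` entry of `𝒰₃` is `−h ρ²`
    have eb : -(ω ^ 2 * h) + ω ^ 4 * h ^ 3 / 4 = -(h * ρ ^ 2) := by rw [hρ2]; unfold rhoSq; ring
    -- and `cos θ² + sin θ² = 1` in the form `(1 − ω²h²/2)² + h²ρ² = 1`
    have e2 : h ^ 2 * ρ ^ 2 = 1 - (1 - ω ^ 2 * h ^ 2 / 2) ^ 2 := by rw [hρ2]; unfold rhoSq; ring
    refine Prod.ext ?_ ?_
    · simp only [hoStep_fst]
      field_simp
      ring
    · simp only [hoStep_snd, eb]
      field_simp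
      ring

/-- **The printed orbit**: released from amplitude `A` at rest, after `n` steps
`(φ, π) = (A cos(nθ), −Aρ sin(nθ))`. [cite: JooEtAl2000, §4.1 ((φ(τ), π(τ)) = (A cos κτ, −Aρ sin κτ))] -/
theorem iterate_amplitude {ω h : ℝ} (hω : 0 < ω) (hh : 0 ≤ h) (hlt : ω ^ 2 * h ^ 2 < 4) (n : ℕ)
    (A : ℝ) :
    (hoStep ω h)^[n] (A, 0) =
      (A * Real.cos (n * theta ω h), -(A * Real.sqrt (rhoSq ω h) * Real.sin (n * theta ω h))) := by
  rw [hoStep_iterate_eq_rotation hω hh hlt]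
  refine Prod.ext ?_ ?_ <;> dsimp only <;> ring

/-- **The printed energy violation**: released from amplitude `A` at rest,
`δH_n = −⅛ ω⁴A²δτ² sin²(nθ)` — bounded and oscillating on the stable side.
[cite: JooEtAl2000, §4.1 (δH = −⅛ω⁴A²δτ² sin²[κ(δτ)τ])] -/
theorem deltaH_amplitude {ω h : ℝ} (hω : 0 < ω) (hh : 0 ≤ h) (hlt : ω ^ 2 * h ^ 2 < 4) (n : ℕ)
    (A : ℝ) :
    hoEnergy ω ((hoStep ω h)^[n] (A, 0)) - hoEnergy ω (A, 0) =
      -(ω ^ 4 * A ^ 2 * h ^ 2 / 8 * Real.sin (n * theta ω h) ^ 2) := by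
  rw [hoEnergy_iterate_sub, iterate_amplitude hω hh hlt]
  dsimp only
  linear_combination (ω ^ 4 * A ^ 2 * h ^ 2 / 8) * Real.sin_sq_add_cos_sq (n * theta ω h)

/-! ### The unstable side `ωδτ > 2`: real eigenvalues, geometric divergence of `δH` -/

/-- `ρ² < 0` for `ω²δτ² > 4` (`ω ≠ 0`): the orbit conic is a hyperbola.
[cite: JooEtAl2000, §4.1 ("whereas for ωδτ > 2 they are hyperbolic")] -/
theorem rhoSq_neg {ω h : ℝ} (hω : 0 < ω) (hgt : 4 < ω ^ 2 * h ^ 2) : rhoSq ω h < 0 := by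
  unfold rhoSq
  have h1 : 1 - ω ^ 2 * h ^ 2 / 4 < 0 := by linarith
  exact mul_neg_of_pos_of_neg (by positivity) h1

/-- The larger real eigenvalue `λ₊ = 1 − ½x² + x√(¼x² − 1)`, `x = ωδτ`.
[cite: JooEtAl2000, §4.2 (case 2: λ₁ = η, λ₂ = 1/η real)] [cite: EdwardsHorvathKennedy1996, §5.1
(ν = ±(1/δτ) Re ln[½δτ² − 1 ± δτ√(¼δτ² − 1)])] -/
def lamPlus (x : ℝ) : ℝ := 1 - x ^ 2 / 2 + x * Real.sqrt (x ^ 2 / 4 - 1)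

/-- The smaller real eigenvalue `λ₋ = 1 − ½x² − x√(¼x² − 1)`, `x = ωδτ`.
[cite: JooEtAl2000, §4.2 (case 2)] [cite: EdwardsHorvathKennedy1996, §5.1 (exponent ν)] -/
def lamMinus (x : ℝ) : ℝ := 1 - x ^ 2 / 2 - x * Real.sqrt (x ^ 2 / 4 - 1)

/-- `λ₊ λ₋ = 1 = det 𝒰₃` (for `x² ≥ 4`). [cite: JooEtAl2000, §4.2 ("λ₁λ₂ = 1")] -/
theorem lamPlus_mul_lamMinus {x : ℝ} (hx : 4 ≤ x ^ 2) : lamPlus x * lamMinus x = 1 := by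
  unfold lamPlus lamMinus
  have h1 : 0 ≤ x ^ 2 / 4 - 1 := by linarith
  nlinarith [Real.sq_sqrt h1]

/-- `λ₊ + λ₋ = 2 − x² = tr 𝒰₃`. [cite: JooEtAl2000, §4.2] -/
theorem lamPlus_add_lamMinus (x : ℝ) : lamPlus x + lamMinus x = 2 - x ^ 2 := by
  unfold lamPlus lamMinus
  ring

/-- `λ±` are the roots of the characteristic polynomial `λ² − (2 − x²)λ + 1` of `𝒰₃`
(`x = ωδτ`, `x² ≥ 4`). [cite: JooEtAl2000, §4.2 (characteristic polynomial of 𝒰₃(δτ))] -/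
theorem lamMinus_charpoly {x : ℝ} (hx : 4 ≤ x ^ 2) :
    lamMinus x ^ 2 - (2 - x ^ 2) * lamMinus x + 1 = 0 := by
  have h1 := lamPlus_mul_lamMinus hx
  have h2 := lamPlus_add_lamMinus x
  nlinarith [h1, h2]

/-- **On the unstable side `λ₋ < −1`** (so `|λ₋| > 1 > |λ₊|`: "exponential divergence with
`N_MD`"). [cite: JooEtAl2000, §4.2 (case 2)] [cite: EdwardsHorvathKennedy1996, §5.1] -/
theorem lamMinus_lt_neg_one {x : ℝ} (hx0 : 0 < x) (hx : 4 < x ^ 2) : lamMinus x < -1 := by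
  unfold lamMinus
  have h1 : 0 < x ^ 2 / 4 - 1 := by linarith
  have h2 : 0 < Real.sqrt (x ^ 2 / 4 - 1) := Real.sqrt_pos.mpr h1
  have h3 : 0 < x * Real.sqrt (x ^ 2 / 4 - 1) := mul_pos hx0 h2
  linarith

/-- The eigenvector of `𝒰₃(δτ)` for `λ₋`: `v₋ = (δτ, λ₋ − (1 − ½ω²δτ²))`.
[cite: JooEtAl2000, §4.2 (eigenvalues of 𝒰₃(δτ))] -/
def eigMinus (ω h : ℝ) : ℝ × ℝ := (h, lamMinus (ω * h) - (1 - ω ^ 2 * h ^ 2 / 2))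

/-- `𝒰₃(δτ) v₋ = λ₋ v₋` for `ω²δτ² ≥ 4`. [cite: JooEtAl2000, §4.2 (case 2: real eigenvalues η, 1/η)] -/
theorem hoStep_eigMinus {ω h : ℝ} (hx : 4 ≤ ω ^ 2 * h ^ 2) :
    hoStep ω h (eigMinus ω h) = lamMinus (ω * h) • eigMinus ω h := by
  have hx' : 4 ≤ (ω * h) ^ 2 := by rw [mul_pow]; exact hx
  have h1 : 0 ≤ (ω * h) ^ 2 / 4 - 1 := by linarith
  have hsq := Real.sq_sqrt h1
  refine Prod.ext ?_ ?_
  · simp only [hoStep_fst, eigMinus, Prod.smul_mk, smul_eq_mul]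
    ring
  · simp only [hoStep_snd, eigMinus, Prod.smul_mk, smul_eq_mul]
    unfold lamMinus
    linear_combination (-(ω * h) ^ 2) * hsq

/-- `𝒰₃(δτ)ⁿ v₋ = λ₋ⁿ v₋`. [cite: JooEtAl2000, §4.2 ("On raising λ₁ or λ₂ to the power N_MD …")] -/
theorem iterate_eigMinus {ω h : ℝ} (hx : 4 ≤ ω ^ 2 * h ^ 2) (n : ℕ) :
    (hoStep ω h)^[n] (eigMinus ω h) = lamMinus (ω * h) ^ n • eigMinus ω h := by
  induction n with
  | zero => simp
  | succ n ih =>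
    rw [Function.iterate_succ_apply', ih]
    have hlin : ∀ (c : ℝ) (v : ℝ × ℝ), hoStep ω h (c • v) = c • hoStep ω h v := by
      intro c v
      refine Prod.ext ?_ ?_ <;>
        simp only [hoStep_fst, hoStep_snd, Prod.smul_fst, Prod.smul_snd, smul_eq_mul] <;> ring
    rw [hlin, hoStep_eigMinus hx, smul_smul, pow_succ]

/-- The field component along `v₋` grows geometrically: `φ_n = λ₋ⁿ δτ`, `|λ₋| > 1`.
[cite: JooEtAl2000, §4.2 (exponential divergence with N_MD)] -/
theorem fst_iterate_eigMinus {ω h : ℝ} (hx : 4 ≤ ω ^ 2 * h ^ 2) (n : ℕ) :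
    ((hoStep ω h)^[n] (eigMinus ω h)).1 = lamMinus (ω * h) ^ n * h := by
  rw [iterate_eigMinus hx n]
  simp [eigMinus]

/-- **Geometric divergence of the energy violation on the unstable side**: for `0 < ω`, `0 < δτ`,
`ωδτ > 2`, along the eigen-direction `v₋` one has `δH_n = ⅛ ω⁴δτ⁴ (λ₋^{2n} − 1)` with `λ₋² > 1`,
so `δH_n → +∞` ("causing `δH` to diverge"; "`T` … growing proportionally to `e^{ντ}`").
[cite: JooEtAl2000, §4.1–§4.2] [cite: EdwardsHorvathKennedy1996, §5.1 (exponent ν)] -/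
theorem tendsto_hoEnergy_iterate_atTop {ω h : ℝ} (hω : 0 < ω) (hh : 0 < h) (hgt : 2 < ω * h) :
    Tendsto (fun n : ℕ => hoEnergy ω ((hoStep ω h)^[n] (eigMinus ω h)) - hoEnergy ω (eigMinus ω h))
      atTop atTop := by
  have hx : 4 < ω ^ 2 * h ^ 2 := by nlinarith
  have hform : ∀ n : ℕ, hoEnergy ω ((hoStep ω h)^[n] (eigMinus ω h)) - hoEnergy ω (eigMinus ω h) =
      ω ^ 4 * h ^ 4 / 8 * (lamMinus (ω * h) ^ 2) ^ n - ω ^ 4 * h ^ 4 / 8 := by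
    intro n
    rw [hoEnergy_iterate_sub, fst_iterate_eigMinus hx.le n]
    simp only [eigMinus]
    rw [← pow_mul, mul_comm 2 n, pow_mul]
    ring
  simp_rw [hform]
  have hlam : 1 < lamMinus (ω * h) ^ 2 := by
    have h1 := lamMinus_lt_neg_one (mul_pos hω hh) (by rw [mul_pow]; exact hx)
    nlinarith
  have hc : 0 < ω ^ 4 * h ^ 4 / 8 := by positivity
  refine tendsto_atTop_add_const_right _ _ ?_
  exact Tendsto.const_mul_atTop hc (tendsto_pow_atTop_atTop_of_one_lt hlam)

/-! ### The wall `ωδτ = 2` -/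

/-- At `ωδτ = 2` the update degenerates to `𝒰₃ = [[−1, δτ], [0, −1]]`.
[cite: JooEtAl2000, §4.1 ("The instability at ωδτ = 2 is the abrupt transition …")] -/
theorem hoStep_wall {ω h : ℝ} (hx : ω * h = 2) (v : ℝ × ℝ) :
    hoStep ω h v = (-v.1 + h * v.2, -v.2) := by
  have h2 : ω ^ 2 * h ^ 2 = 4 := by rw [← mul_pow, hx]; norm_num
  have h3 : ω ^ 4 * h ^ 3 = 4 * ω ^ 2 * h := by
    have : ω ^ 4 * h ^ 3 = (ω ^ 2 * h ^ 2) * (ω ^ 2 * h) := by ring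
    rw [this, h2]; ring
  refine Prod.ext ?_ ?_
  · simp only [hoStep_fst]
    linear_combination (-(v.1) / 2) * h2
  · simp only [hoStep_snd]
    linear_combination (v.1 / 4) * h3 + (-(v.2) / 2) * h2

/-- … whose iterates grow LINEARLY: `𝒰₃ⁿ(φ, π) = ((−1)ⁿ(φ − n δτ π), (−1)ⁿ π)` — the marginal
case between oscillation and geometric divergence. [cite: JooEtAl2000, §4.1–§4.2 (the transition at
ωδτ = 2: coalescing eigenvalues λ₁ = λ₂ = −1)] -/
theorem iterate_wall {ω h : ℝ} (hx : ω * h = 2) (n : ℕ) (v : ℝ × ℝ) :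
    (hoStep ω h)^[n] v = ((-1) ^ n * (v.1 - n * h * v.2), (-1) ^ n * v.2) := by
  induction n with
  | zero => simp
  | succ n ih =>
    rw [Function.iterate_succ_apply', ih, hoStep_wall hx]
    refine Prod.ext ?_ ?_
    · simp only
      push_cast
      ring
    · simp only
      ring

end Harmonic

end Literature.Probability.MarkovChains.HMC

end
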